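import Literature.Geometry.Lorentzian.AchronalBoundaryProofs
import HarnessLib

/-!
# Crux `GenericCensorshipCollarMargin` (stmt-FinalStateConjecture-10809), line `deficit-ratchet` (r3):
# stub B1 `stub_achronalBoundary` — Hawking–Ellis Prop. 6.3.1 at universe `0`

Route `BartnikGapSettling`; helper (`--supports stmt-FinalStateConjecture-10809`) landing the registered
stub `stub_achronalBoundary : HawkingEllis1973_achronalBoundary.{0}` of the line skeleton
`Cruxes/GenericCensorshipCollarMargin/Lines/deficit_ratchet.lean` (§4, reshape r3), which its proved
glue `horizonAreaTheorem_of` (the event-horizon area theorem over tight achronal slicings, from the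
tree's `VacuumCauchyDevelopment.horizonCutArea_le_of_achronalBoundary`) consumes as the hypothesis
`h631`. The named fact is DISCHARGED in the tree: `HawkingEllis1973_achronalBoundary_holds`
(`Literature/Geometry/Lorentzian/AchronalBoundaryProofs.lean`), universe-polymorphic; this file is its
universe-`0` instance under the registered name.
-/

noncomputable section

-- D-0017: single-problem summit, `Summit.<S>.<S>.…` by design (cf. lakefile `weak.linter.dupNamespace`).
set_option linter.dupNamespace false

namespace Summit.FinalStateConjecture.FinalStateConjecture.Theorems

open Literature.Geometry.Lorentzian

/-- **Stub B1 of line `deficit-ratchet` (crux stmt-FinalStateConjecture-10809)**: the boundary of a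
future set of a `4`-dimensional spacetime is closed, achronal and an embedded topological
`3`-submanifold (Hawking–Ellis 1973, Prop. 6.3.1), in the catalogued form
`HawkingEllis1973_achronalBoundary` at universe `0` — by the tree's discharge
`HawkingEllis1973_achronalBoundary_holds`. [cite: HawkingEllis1973, §6.3, Prop. 6.3.1 (p. 187)] -/
theorem stub_achronalBoundary : HawkingEllis1973_achronalBoundary.{0} :=
  HawkingEllis1973_achronalBoundary_holds

end Summit.FinalStateConjecture.FinalStateConjecture.Theorems

end
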